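import Summits.QuantumFields.YangMills.Theorems.LangevinControlUVFemtoCurvatureTwoPointCTorusLower
import HarnessLib

/-!
# The TORON BOX of the torus `(ℤ/L)⁴` in the comb gauge: small action and exact product-Haar mass
# (helper for `TwistExponentGap.PeriodicToronFloor`, item stmt-QuantumFields-24055)

Support file (`--supports stmt-QuantumFields-24055`) of route `TwistExponentGap` (seat ym-idea-4, LINE g13-A, DRAFT by design →
`MarginalTwistOnset.FixedTorusCriterionFailure` ⟨16128⟩); consumed by the closing module `TwistExponentGapPeriodicToronFloor`.

* §1 Hilbert–Schmidt algebra (unitary `ρ`): the plaquette word `(Cᵢa)(Cⱼb)(Cᵢa')⁻¹(Cⱼb')⁻¹` is within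
  `‖ρa−1‖+‖ρb−1‖+‖ρa'−1‖+‖ρb'−1‖ + 2‖ρCᵢ−1‖‖ρCⱼ−1‖` of `1` — drop the four fluctuation letters by unitary invariance of the norm
  (`norm_insert_letter`), leaving the commutator: `CᵢCⱼCᵢ⁻¹Cⱼ⁻¹ − 1 = (CᵢCⱼ − CⱼCᵢ)Cᵢ⁻¹Cⱼ⁻¹`, `CᵢCⱼ − CⱼCᵢ = (Cᵢ−1)(Cⱼ−1) − (Cⱼ−1)(Cᵢ−1)`.
* §2 THE TORON BOX forces a small action: if every link `V(x,μ)` is `t₂`-close to its seam letter (`C μ` when the link crosses the seam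
  `x_μ = L−1`, else `1`) and the letters are `t₁`-close to `1`, every plaquette is `(4t₂ + 2t₁²)`-close to `1` — the two `μ`-links of a
  `(μ,ν)`-plaquette cross the `μ`-seam together (base points differ by `e_ν`) — so `S(V) ≤ (4t₂+2t₁²)²/2 · #P`
  (`N − Re tr ρ g = ½‖ρ g − 1‖²`, ✓`DoublingOfRV.sub_re_trace_le`).
* §3 In the comb gauge of ✓`LangevinControlUVFemtoCurvatureTwoPointCTorus{CombGauge,Lower}` (the `3L⁴+1` off-comb links are i.i.d. Haar,
  ✓`map_combSection_pi_haar`) the toron event — the 4 leader seam links `(−e_μ, μ)` in `B_{t₁} = {‖ρ g − 1‖ ≤ t₁}`, every other off-comb link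
  within `t₂` of its letter (`‖ρ(letter⁻¹·W_e) − 1‖ ≤ t₂`) — has product-Haar mass EXACTLY `Haar(B_{t₁})⁴ · Haar(B_{t₂})^{3L⁴−3}`: the skew
  product `(leaders, rest) ↦ (leaders, letter⁻¹·rest)` preserves product Haar (`MeasurePreserving.skew_product`,
  `measurePreserving_piEquivPiSubtypeProd`, left invariance; template ✓`…CSkewHaar.map_pi_haar_twoSided_eq_of_pred`), and on it the gauge-fixed
  configuration lies in the toron box of §2; hence ★ `pow_mul_pow_le_measureReal_wilsonAction_le`:
  `π{S ≤ (4t₂+2t₁²)²/2·#P} ≥ Haar(B_{t₁})⁴ · Haar(B_{t₂})^{3L⁴−3}`.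

HONEST FRAMING: fixed-torus Haar-measure bookkeeping ([cite: Chatterjee2016, §9 Lemma 9.3]; [cite: Luscher1983, §2]; [cite: Vanbaal2001]); nothing of
the route's ceilings, of ⟨16128⟩, of any rung or summit is proved; the Yang–Mills mass gap is NOT proved (width seat ym-line-sfw-p2-w3 g35 of cell
ym-idea-1, free hands).  THEOREMS ONLY (0 `def`, 0 `sorry`), standard axioms.
-/

set_option autoImplicit false

noncomputable section

open scoped Matrix.Norms.Frobenius ENNReal BigOperators
open MeasureTheory
open Literature.MathematicalPhysics.QuantumFieldTheory
open Summit.QuantumFields.YangMills.Theorems.FreeEnergyLogCoefficient (dimE exists_haar_gball_ge measurableSet_gball norm_rho_sub_rho)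
open Summit.QuantumFields.YangMills.Theorems.FemtoCurvatureTwoPoint.DoublingOfRV (norm_rho_mul_sub_one_le norm_rho_inv_sub_one
  sub_re_trace_le card_plaquette)
open Summit.QuantumFields.YangMills.Theorems.FemtoCurvatureTwoPointC.TorusGauge

namespace Summit.QuantumFields.YangMills.Theorems.TwistExponentGap.ToronFloor

/-! ## §1 Frobenius-norm algebra: a plaquette word around two commuting-up-to-`t²` seam holonomies -/

section Algebra

variable {G : Type*} [Group G] {N : ℕ} (ρ : G →* Matrix (Fin N) (Fin N) ℂ)
  (hU : ∀ g, ρ g ∈ Matrix.unitaryGroup (Fin N) ℂ)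

include hU in
/-- Dropping one letter next to `1` inside a word costs its distance to `1`: `‖ρ(u)(ρ(g)ρ(v)) − ρ(u)ρ(v)‖ = ‖ρ g − 1‖`
(left and right unitary invariance of the Hilbert–Schmidt norm). [folklore] -/
theorem norm_insert_letter (u g v : G) : ‖ρ u * (ρ g * ρ v) - ρ u * ρ v‖ = ‖ρ g - 1‖ := by
  have e : ρ u * (ρ g * ρ v) - ρ u * ρ v = ρ u * ((ρ g - 1) * ρ v) := by
    rw [sub_mul, one_mul, Matrix.mul_sub]
  rw [e, Matrix.frobenius_norm_unitaryGroup_mul ⟨ρ u, hU u⟩, Matrix.frobenius_norm_mul_unitaryGroup _ ⟨ρ v, hU v⟩]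

include hU in
/-- The commutator of two elements `t₁`-, `t₂`-close to `1` is `2t₁t₂`-close to `1`:
`‖ρ(x y x⁻¹ y⁻¹) − 1‖ ≤ 2 ‖ρ x − 1‖ ‖ρ y − 1‖` (`xy − yx = (x−1)(y−1) − (y−1)(x−1)`). [folklore] -/
theorem norm_rho_commutator_sub_one_le (x y : G) :
    ‖ρ (x * y * x⁻¹ * y⁻¹) - 1‖ ≤ 2 * (‖ρ x - 1‖ * ‖ρ y - 1‖) := by
  have hw : ρ (x * y * x⁻¹ * y⁻¹) - 1 = (ρ x * ρ y - ρ y * ρ x) * ρ (x⁻¹ * y⁻¹) := by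
    have h1 : ρ (x * y * x⁻¹ * y⁻¹) = ρ x * ρ y * ρ (x⁻¹ * y⁻¹) := by
      rw [← map_mul, ← map_mul]; congr 1; group
    have h2 : ρ y * ρ x * ρ (x⁻¹ * y⁻¹) = 1 := by
      rw [← map_mul, ← map_mul, ← map_one ρ]; congr 1; group
    rw [sub_mul, h2, h1]
  have hc : ρ x * ρ y - ρ y * ρ x = (ρ x - 1) * (ρ y - 1) - (ρ y - 1) * (ρ x - 1) := by
    simp only [sub_mul, mul_sub, mul_one, one_mul]; abel
  rw [hw, Matrix.frobenius_norm_mul_unitaryGroup _ ⟨ρ (x⁻¹ * y⁻¹), hU _⟩, hc]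
  calc ‖(ρ x - 1) * (ρ y - 1) - (ρ y - 1) * (ρ x - 1)‖
      ≤ ‖(ρ x - 1) * (ρ y - 1)‖ + ‖(ρ y - 1) * (ρ x - 1)‖ := norm_sub_le _ _
    _ ≤ ‖ρ x - 1‖ * ‖ρ y - 1‖ + ‖ρ y - 1‖ * ‖ρ x - 1‖ := add_le_add (norm_mul_le _ _) (norm_mul_le _ _)
    _ = 2 * (‖ρ x - 1‖ * ‖ρ y - 1‖) := by ring

include hU in
/-- ★ **The plaquette word around two seam holonomies.**  For `Cᵢ, Cⱼ` (the seam holonomies met by the plaquette, or `1`) and fluctuations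
`a, b, a', b'`: `‖ρ((Cᵢa)(Cⱼb)(Cᵢa')⁻¹(Cⱼb')⁻¹) − 1‖ ≤ ‖ρa−1‖ + ‖ρb−1‖ + ‖ρa'−1‖ + ‖ρb'−1‖ + 2‖ρCᵢ−1‖‖ρCⱼ−1‖` — drop the four
fluctuation letters one by one (`norm_insert_letter`), leaving the commutator `CᵢCⱼCᵢ⁻¹Cⱼ⁻¹` (`norm_rho_commutator_sub_one_le`).
[cite: Balaban1985Averaging, (19) p.21] -/
theorem norm_rho_plaquetteWord_sub_one_le (Ci Cj a b a' b' : G) :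
    ‖ρ (Ci * a * (Cj * b) * (Ci * a')⁻¹ * (Cj * b')⁻¹) - 1‖ ≤
      ‖ρ a - 1‖ + ‖ρ b - 1‖ + ‖ρ a' - 1‖ + ‖ρ b' - 1‖ + 2 * (‖ρ Ci - 1‖ * ‖ρ Cj - 1‖) := by
  -- the word and its four truncations
  set r₁ : G := Cj * b * a'⁻¹ * Ci⁻¹ * b'⁻¹ * Cj⁻¹ with hr₁
  set r₂ : G := a'⁻¹ * Ci⁻¹ * b'⁻¹ * Cj⁻¹ with hr₂
  set r₃ : G := Ci⁻¹ * b'⁻¹ * Cj⁻¹ with hr₃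
  have hw0 : ρ (Ci * a * (Cj * b) * (Ci * a')⁻¹ * (Cj * b')⁻¹) = ρ Ci * (ρ a * ρ r₁) := by
    rw [← map_mul, ← map_mul]; congr 1; rw [hr₁]; group
  have hw1 : ρ Ci * ρ r₁ = ρ (Ci * Cj) * (ρ b * ρ r₂) := by
    rw [← map_mul, ← map_mul, ← map_mul]; congr 1; rw [hr₁, hr₂]; group
  have hr23 : r₂ = a'⁻¹ * r₃ := by rw [hr₂, hr₃]; group
  have hw2 : ρ (Ci * Cj) * ρ r₂ = ρ (Ci * Cj) * (ρ a'⁻¹ * ρ r₃) := by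
    congr 1; rw [hr23, map_mul]
  have hw3 : ρ (Ci * Cj) * ρ r₃ = ρ (Ci * Cj * Ci⁻¹) * (ρ b'⁻¹ * ρ Cj⁻¹) := by
    rw [← map_mul, ← map_mul, ← map_mul]; congr 1; rw [hr₃]; group
  have hw4 : ρ (Ci * Cj * Ci⁻¹) * ρ Cj⁻¹ = ρ (Ci * Cj * Ci⁻¹ * Cj⁻¹) := by rw [← map_mul]
  -- the four letter drops
  have d1 : ‖ρ Ci * (ρ a * ρ r₁) - ρ Ci * ρ r₁‖ = ‖ρ a - 1‖ := norm_insert_letter ρ hU _ _ _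
  have d2 : ‖ρ (Ci * Cj) * (ρ b * ρ r₂) - ρ (Ci * Cj) * ρ r₂‖ = ‖ρ b - 1‖ := norm_insert_letter ρ hU _ _ _
  have d3 : ‖ρ (Ci * Cj) * (ρ a'⁻¹ * ρ r₃) - ρ (Ci * Cj) * ρ r₃‖ = ‖ρ a' - 1‖ := by
    rw [norm_insert_letter ρ hU, norm_rho_inv_sub_one ρ hU]
  have d4 : ‖ρ (Ci * Cj * Ci⁻¹) * (ρ b'⁻¹ * ρ Cj⁻¹) - ρ (Ci * Cj * Ci⁻¹) * ρ Cj⁻¹‖ = ‖ρ b' - 1‖ := by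
    rw [norm_insert_letter ρ hU, norm_rho_inv_sub_one ρ hU]
  have d5 := norm_rho_commutator_sub_one_le ρ hU Ci Cj
  -- telescope
  rw [hw0]
  calc ‖ρ Ci * (ρ a * ρ r₁) - 1‖
      ≤ ‖ρ Ci * (ρ a * ρ r₁) - ρ Ci * ρ r₁‖ + ‖ρ Ci * ρ r₁ - 1‖ := norm_sub_le_norm_sub_add_norm_sub _ _ _
    _ ≤ ‖ρ a - 1‖ + (‖ρ b - 1‖ + (‖ρ a' - 1‖ + (‖ρ b' - 1‖ + 2 * (‖ρ Ci - 1‖ * ‖ρ Cj - 1‖)))) := by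
        rw [d1]
        refine add_le_add le_rfl ?_
        rw [hw1]
        calc ‖ρ (Ci * Cj) * (ρ b * ρ r₂) - 1‖
            ≤ ‖ρ (Ci * Cj) * (ρ b * ρ r₂) - ρ (Ci * Cj) * ρ r₂‖ + ‖ρ (Ci * Cj) * ρ r₂ - 1‖ :=
              norm_sub_le_norm_sub_add_norm_sub _ _ _
          _ ≤ ‖ρ b - 1‖ + (‖ρ a' - 1‖ + (‖ρ b' - 1‖ + 2 * (‖ρ Ci - 1‖ * ‖ρ Cj - 1‖))) := by
              rw [d2]
              refine add_le_add le_rfl ?_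
              rw [hw2]
              calc ‖ρ (Ci * Cj) * (ρ a'⁻¹ * ρ r₃) - 1‖
                  ≤ ‖ρ (Ci * Cj) * (ρ a'⁻¹ * ρ r₃) - ρ (Ci * Cj) * ρ r₃‖ + ‖ρ (Ci * Cj) * ρ r₃ - 1‖ :=
                    norm_sub_le_norm_sub_add_norm_sub _ _ _
                _ ≤ ‖ρ a' - 1‖ + (‖ρ b' - 1‖ + 2 * (‖ρ Ci - 1‖ * ‖ρ Cj - 1‖)) := by
                    rw [d3]
                    refine add_le_add le_rfl ?_
                    rw [hw3]
                    calc ‖ρ (Ci * Cj * Ci⁻¹) * (ρ b'⁻¹ * ρ Cj⁻¹) - 1‖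
                        ≤ ‖ρ (Ci * Cj * Ci⁻¹) * (ρ b'⁻¹ * ρ Cj⁻¹) - ρ (Ci * Cj * Ci⁻¹) * ρ Cj⁻¹‖ +
                            ‖ρ (Ci * Cj * Ci⁻¹) * ρ Cj⁻¹ - 1‖ := norm_sub_le_norm_sub_add_norm_sub _ _ _
                      _ ≤ ‖ρ b' - 1‖ + 2 * (‖ρ Ci - 1‖ * ‖ρ Cj - 1‖) := by
                          rw [d4, hw4]; exact add_le_add le_rfl d5
    _ = _ := by ring

end Algebra

/-! ## §2 The toron box forces a small action -/

section ActionBound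

variable {G : Type*} [Group G] {N : ℕ} (ρ : G →* Matrix (Fin N) (Fin N) ℂ)
  (hU : ∀ g, ρ g ∈ Matrix.unitaryGroup (Fin N) ℂ)
variable {L : ℕ} [NeZero L]

omit [NeZero L] in
include hU in
/-- ★ **Plaquettes in the toron box.**  Let `C : Fin 4 → G` be seam holonomies `t₁`-close to `1` and suppose every link `V(x, μ)` of the
configuration is `t₂`-close to its seam letter — to `C μ` if the link crosses the seam `x_μ = L − 1`, to `1` otherwise
(`‖ρ(letter⁻¹ · V(x,μ)) − 1‖ ≤ t₂`).  Then every plaquette holonomy is `(4t₂ + 2t₁²)`-close to `1`: the two `μ`-links of a `(μ,ν)`-plaquette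
cross the `μ`-seam together (their base points differ by `e_ν`), so the plaquette is the word `(Cᵢa)(Cⱼb)(Cᵢa')⁻¹(Cⱼb')⁻¹` of
`norm_rho_plaquetteWord_sub_one_le`. [cite: Balaban1985Averaging, (19) p.21] -/
theorem norm_rho_plaquetteHolonomy_sub_one_le_of_toron {V : GaugeConfig 4 L G} (C : Fin 4 → G) {t₁ t₂ : ℝ}
    (ht₁ : 0 ≤ t₁) (hC : ∀ μ, ‖ρ (C μ) - 1‖ ≤ t₁)
    (hV : ∀ e : Edge 4 L, ‖ρ ((if (e.1 e.2).val + 1 = L then C e.2 else 1)⁻¹ * V e) - 1‖ ≤ t₂)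
    (x : Site 4 L) {i j : Fin 4} (hij : i ≠ j) :
    ‖ρ (plaquetteHolonomy V x i j) - 1‖ ≤ 4 * t₂ + 2 * t₁ ^ 2 := by
  -- the seam letters of the links
  set Cf : Edge 4 L → G := fun e => if (e.1 e.2).val + 1 = L then C e.2 else 1 with hCf
  have hCf1 : ∀ e, ‖ρ (Cf e) - 1‖ ≤ t₁ := by
    intro e
    simp only [hCf]
    split_ifs
    · exact hC _
    · rw [map_one, sub_self, norm_zero]; exact ht₁
  have hV' : ∀ e : Edge 4 L, ‖ρ ((Cf e)⁻¹ * V e) - 1‖ ≤ t₂ := hV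
  have hshift_i : Cf (x.shift j, i) = Cf (x, i) := by
    simp only [hCf, shift_apply_of_ne x hij]
  have hshift_j : Cf (x.shift i, j) = Cf (x, j) := by
    simp only [hCf, shift_apply_of_ne x hij.symm]
  -- write each link as `letter · fluctuation`
  have hsplit : ∀ e, V e = Cf e * ((Cf e)⁻¹ * V e) := fun e => (mul_inv_cancel_left _ _).symm
  unfold plaquetteHolonomy
  rw [hsplit (x, i), hsplit (x.shift i, j), hsplit (x.shift j, i), hsplit (x, j), hshift_i, hshift_j]
  refine (norm_rho_plaquetteWord_sub_one_le ρ hU _ _ _ _ _ _).trans ?_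
  have h1 := hV' (x, i)
  have h2 := hV' (x.shift i, j)
  have h3 := hV' (x.shift j, i)
  have h4 := hV' (x, j)
  rw [hshift_j] at h2
  rw [hshift_i] at h3
  have hc : ‖ρ (Cf (x, i)) - 1‖ * ‖ρ (Cf (x, j)) - 1‖ ≤ t₁ * t₁ :=
    mul_le_mul (hCf1 (x, i)) (hCf1 (x, j)) (norm_nonneg _) ht₁
  have hsq : t₁ ^ 2 = t₁ * t₁ := sq t₁
  linarith [h1, h2, h3, h4, hc]

include hU in
/-- ★ **The toron box forces a small action**: under the hypotheses of `norm_rho_plaquetteHolonomy_sub_one_le_of_toron`,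
`S(V) ≤ (4t₂ + 2t₁²)²/2 · #P` (`N − Re tr ρ g = ½‖ρ g − 1‖²`). [cite: Balaban1987RG1, (0.14) p.254] -/
theorem wilsonAction_le_of_toron {V : GaugeConfig 4 L G} (C : Fin 4 → G) {t₁ t₂ : ℝ}
    (ht₁ : 0 ≤ t₁) (hC : ∀ μ, ‖ρ (C μ) - 1‖ ≤ t₁)
    (hV : ∀ e : Edge 4 L, ‖ρ ((if (e.1 e.2).val + 1 = L then C e.2 else 1)⁻¹ * V e) - 1‖ ≤ t₂) :
    wilsonAction ρ V ≤ (4 * t₂ + 2 * t₁ ^ 2) ^ 2 / 2 * Fintype.card (Plaquette 4 L) := by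
  unfold wilsonAction
  calc ∑ p : Plaquette 4 L, ((N : ℝ) - (ρ (plaquetteHolonomy V p.1 p.2.1.1 p.2.1.2)).trace.re)
      ≤ ∑ _p : Plaquette 4 L, (4 * t₂ + 2 * t₁ ^ 2) ^ 2 / 2 := Finset.sum_le_sum fun p _ =>
        sub_re_trace_le ρ hU _ (norm_rho_plaquetteHolonomy_sub_one_le_of_toron ρ hU C ht₁ hC hV p.1 (ne_of_lt p.2.2))
    _ = (4 * t₂ + 2 * t₁ ^ 2) ^ 2 / 2 * Fintype.card (Plaquette 4 L) := by
        rw [Finset.sum_const, Finset.card_univ, nsmul_eq_mul]; ring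

end ActionBound

/-! ## §3 The toron box in the comb gauge and its product-Haar mass -/

section ToronBox

variable {n : ℕ} {G : Type} [Group G] [TopologicalSpace G] [IsTopologicalGroup G] [CompactSpace G]
  [MeasurableSpace G] [BorelSpace G] [SecondCountableTopology G]
  {N : ℕ} (ρ : G →* Matrix (Fin N) (Fin N) ℂ)

omit [TopologicalSpace G] [IsTopologicalGroup G] [CompactSpace G] [MeasurableSpace G] [BorelSpace G] [SecondCountableTopology G] in
/-- The leader seam link of direction `μ`, `(−e_μ, μ)` (base point `x_μ = L − 1`, other coordinates `0`), is off the comb. [folklore] -/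
theorem leader_not_mem_combEdges (μ : Fin 4) : (Pi.single μ (-1 : ZMod (n + 1)), μ) ∉ combEdges (n + 1) := by
  rw [mem_combEdges]
  rintro ⟨-, h⟩
  simp only [Pi.single_eq_same, ZMod.val_neg_one] at h
  omega

/-- ★ **THE TORON BOX HAS PRODUCT-HAAR MASS `Haar(B_{t₁})⁴ · Haar(B_{t₂})^{3L⁴−3}` AND A SMALL ACTION.**  On the torus `(ℤ/L)⁴`, `L = n+1`,
for a continuous unitary `ρ` and `0 ≤ t₁, t₂`:
`π{U | S(U) ≤ (4t₂ + 2t₁²)²/2 · #P} ≥ Haar{‖ρ g − 1‖ ≤ t₁}⁴ · Haar{‖ρ g − 1‖ ≤ t₂}^{3L⁴−3}`.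
Mechanism: gauge-fix on the comb (`map_combSection_pi_haar`: the off-comb links of the comb gauge are i.i.d. Haar); the TORON BOX of the
`3L⁴+1` off-comb links = the 4 leader seam links `(−e_μ, μ)` in `B_{t₁}`, every other seam link `(x, μ)`, `x_μ = L−1`, within `t₂` of its leader
(`‖ρ(W_e) − ρ(W_{ℓ_μ})‖ ≤ t₂`), every non-seam link in `B_{t₂}`; its mass is computed by the skew product `(leaders, rest) ↦ (leaders, leader⁻¹·rest)`
which preserves product Haar (`MeasurePreserving.skew_product`, left invariance), and on it `wilsonAction_le_of_toron` applies.
[cite: Chatterjee2016, Lemma 9.3] [cite: Luscher1983, §2] -/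
theorem pow_mul_pow_le_measureReal_wilsonAction_le (hρ : Continuous ρ) (hU : ∀ g, ρ g ∈ Matrix.unitaryGroup (Fin N) ℂ)
    {t₁ t₂ : ℝ} (ht₁ : 0 ≤ t₁) (ht₂ : 0 ≤ t₂) :
    (haarProbability G).real {g : G | ‖ρ g - 1‖ ≤ t₁} ^ 4 *
        (haarProbability G).real {g : G | ‖ρ g - 1‖ ≤ t₂} ^ (3 * (n + 1) ^ 4 - 3) ≤
      (Measure.pi fun _ : Edge 4 (n + 1) => haarProbability G).real
        {U : GaugeConfig 4 (n + 1) G |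
          wilsonAction ρ U ≤ (4 * t₂ + 2 * t₁ ^ 2) ^ 2 / 2 * Fintype.card (Plaquette 4 (n + 1))} := by
  classical
  -- letters
  set ι := {e : Edge 4 (n + 1) // e ∉ combEdges (n + 1)} with hι
  set ℓ : Fin 4 → Edge 4 (n + 1) := fun μ => (Pi.single μ (-1 : ZMod (n + 1)), μ) with hℓ
  have hℓoff : ∀ μ, ℓ μ ∉ combEdges (n + 1) := fun μ => leader_not_mem_combEdges μ
  set Lead : Fin 4 → ι := fun μ => ⟨ℓ μ, hℓoff μ⟩ with hLead
  have hLead_inj : Function.Injective Lead := fun μ ν h => by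
    have := congrArg (fun i : ι => i.1.2) h
    simpa [hLead, hℓ] using this
  set p : ι → Prop := fun i => ∃ μ, i = Lead μ with hp
  set B₁ : Set G := {g : G | ‖ρ g - 1‖ ≤ t₁} with hB₁
  set B₂ : Set G := {g : G | ‖ρ g - 1‖ ≤ t₂} with hB₂
  have hB₁m : MeasurableSet B₁ := measurableSet_gball ρ hρ t₁
  have hB₂m : MeasurableSet B₂ := measurableSet_gball ρ hρ t₂
  -- measures
  set PiM : Measure (ι → G) := Measure.pi fun _ : ι => haarProbability G with hPiM
  set π₁ : Measure ({i // p i} → G) := Measure.pi fun _ : {i // p i} => haarProbability G with hπ₁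
  set π₂ : Measure ({i // ¬p i} → G) := Measure.pi fun _ : {i // ¬p i} => haarProbability G with hπ₂
  haveI : (haarProbability G).IsMulLeftInvariant := by unfold haarProbability; infer_instance
  set e := MeasurableEquiv.piEquivPiSubtypeProd (fun _ : ι => G) p with he_def
  have he : MeasurePreserving e PiM (π₁.prod π₂) := measurePreserving_piEquivPiSubtypeProd (fun _ : ι => haarProbability G) p
  -- the seam letters as functions of the leader coordinates, and the fibre maps
  set c : ({i // p i} → G) → ι → G := fun a i =>
    if (i.1.1 i.1.2).val + 1 = n + 1 then (a ⟨Lead i.1.2, ⟨i.1.2, rfl⟩⟩)⁻¹ else 1 with hc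
  set Φ : ({i // p i} → G) → ({i // ¬p i} → G) → ({i // ¬p i} → G) := fun a b i => c a i.1 * b i with hΦ
  have hΦa : ∀ a, MeasurePreserving (Φ a) π₂ π₂ := fun a =>
    measurePreserving_pi (fun _ : {i // ¬p i} => haarProbability G) (fun _ : {i // ¬p i} => haarProbability G)
      fun i => measurePreserving_mul_left (haarProbability G) (c a i.1)
  have hcm : ∀ i : ι, Measurable fun a : {i // p i} → G => c a i := by
    intro i
    by_cases hs : (i.1.1 i.1.2).val + 1 = n + 1
    · simp only [hc, hs, if_true]; exact (measurable_pi_apply _).inv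
    · simp only [hc, hs, if_false]; exact measurable_const
  have hΦm : Measurable (Function.uncurry Φ) := by
    refine measurable_pi_lambda _ fun i => ?_
    exact ((hcm i.1).comp measurable_fst).mul ((measurable_pi_apply i).comp measurable_snd)
  set sk : ({i // p i} → G) × ({i // ¬p i} → G) → ({i // p i} → G) × ({i // ¬p i} → G) :=
    fun z => (id z.1, Φ z.1 z.2) with hsk
  have hskew : MeasurePreserving sk (π₁.prod π₂) (π₁.prod π₂) :=
    (MeasurePreserving.id π₁).skew_product hΦm (ae_of_all _ fun a => (hΦa a).map_eq)
  -- the box and the toron event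
  set BoxL : Set ({i // p i} → G) := Set.pi Set.univ fun _ => B₁ with hBoxL
  set BoxR : Set ({i // ¬p i} → G) := Set.pi Set.univ fun _ => B₂ with hBoxR
  have hBoxLm : MeasurableSet BoxL := MeasurableSet.univ_pi fun _ => hB₁m
  have hBoxRm : MeasurableSet BoxR := MeasurableSet.univ_pi fun _ => hB₂m
  set P : Set (ι → G) := (fun W => sk (e W)) ⁻¹' (BoxL ×ˢ BoxR) with hP
  have hskm : Measurable sk := hskew.measurable
  have hPm : MeasurableSet P := (hskm.comp e.measurable) (hBoxLm.prod hBoxRm)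
  -- (1) the mass of the toron event
  have hPmass : PiM P = haarProbability G B₁ ^ Fintype.card {i // p i} * haarProbability G B₂ ^ Fintype.card {i // ¬p i} := by
    have h1 : PiM P = (π₁.prod π₂) (BoxL ×ˢ BoxR) :=
      (hskew.comp he).measure_preimage (hBoxLm.prod hBoxRm).nullMeasurableSet
    rw [h1, Measure.prod_prod, hπ₁, hπ₂, Measure.pi_pi, Measure.pi_pi, Finset.prod_const, Finset.prod_const, Finset.card_univ,
      Finset.card_univ]
  -- (2) the cardinalities: 4 leaders, `3L⁴ − 3` others
  have hcardp : Fintype.card {i // p i} = 4 := by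
    have hmem : ∀ i : ι, i ∈ Finset.univ.image Lead ↔ p i := fun i => by
      simp only [Finset.mem_image, Finset.mem_univ, true_and]
      constructor
      · rintro ⟨μ, h⟩; exact ⟨μ, h.symm⟩
      · rintro ⟨μ, h⟩; exact ⟨μ, h.symm⟩
    have h := Fintype.card_of_subtype (Finset.univ.image Lead) hmem
    rw [h, Finset.card_image_of_injective _ hLead_inj, Finset.card_univ, Fintype.card_fin]
  have hcardnp : Fintype.card {i // ¬p i} = 3 * (n + 1) ^ 4 - 3 := by
    rw [Fintype.card_subtype_compl, hcardp, card_offComb]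
    omega
  -- (3) on the toron event the comb-gauged configuration lies in the toron box
  have hPsub : (fun (U : GaugeConfig 4 (n + 1) G) (i : ι) =>
        combHolonomy U i.1.1 * U i.1 * (combHolonomy U (i.1.1.shift i.1.2))⁻¹) ⁻¹' P ⊆
      {U : GaugeConfig 4 (n + 1) G |
        wilsonAction ρ U ≤ (4 * t₂ + 2 * t₁ ^ 2) ^ 2 / 2 * Fintype.card (Plaquette 4 (n + 1))} := by
    intro U hUP
    set W : ι → G := fun i => combHolonomy U i.1.1 * U i.1 * (combHolonomy U (i.1.1.shift i.1.2))⁻¹ with hW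
    have hWP : sk (e W) ∈ BoxL ×ˢ BoxR := hUP
    rw [Set.mem_prod] at hWP
    obtain ⟨hL, hR⟩ := hWP
    -- unpack the box conditions
    have hlead : ∀ μ, ‖ρ (W (Lead μ)) - 1‖ ≤ t₁ := fun μ => by
      have h := (Set.mem_univ_pi.1 hL) ⟨Lead μ, ⟨μ, rfl⟩⟩
      exact h
    have hrest : ∀ i : ι, ¬p i → ‖ρ (c (e W).1 i * W i) - 1‖ ≤ t₂ := fun i hi => by
      have h := (Set.mem_univ_pi.1 hR) ⟨i, hi⟩
      exact h
    -- the comb-gauged configuration and its letters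
    set V : GaugeConfig 4 (n + 1) G := gaugeTransform (combHolonomy U) U with hV
    have hVcomb : ∀ e', e' ∈ combEdges (n + 1) → V e' = 1 := fun e' he' => gaugeTransform_combHolonomy_of_mem U he'
    have hVoff : ∀ (e' : Edge 4 (n + 1)) (he' : e' ∉ combEdges (n + 1)), V e' = W ⟨e', he'⟩ := fun e' he' => rfl
    have hbox : ∀ e' : Edge 4 (n + 1),
        ‖ρ ((if (e'.1 e'.2).val + 1 = n + 1 then W (Lead e'.2) else 1)⁻¹ * V e') - 1‖ ≤ t₂ := by
      intro e'
      by_cases he' : e' ∈ combEdges (n + 1)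
      · have hns : ¬ ((e'.1 e'.2).val + 1 = n + 1) := by
          have := ((mem_combEdges e').1 he').2; omega
        rw [if_neg hns, hVcomb e' he', inv_one, mul_one, map_one, sub_self, norm_zero]
        exact ht₂
      · rw [hVoff e' he']
        by_cases hpi : p ⟨e', he'⟩
        · obtain ⟨μ, hμ⟩ := hpi
          have he'ℓ : e' = ℓ μ := congrArg Subtype.val hμ
          have hs : (e'.1 e'.2).val + 1 = n + 1 := by
            rw [he'ℓ]; simp only [hℓ, Pi.single_eq_same, ZMod.val_neg_one]
          have hμ2 : e'.2 = μ := by rw [he'ℓ]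
          rw [if_pos hs, hμ2, ← hμ, inv_mul_cancel, map_one, sub_self, norm_zero]
          exact ht₂
        · have h := hrest ⟨e', he'⟩ hpi
          have hce : c (e W).1 ⟨e', he'⟩ = (if (e'.1 e'.2).val + 1 = n + 1 then W (Lead e'.2) else 1)⁻¹ := by
            by_cases hs : (e'.1 e'.2).val + 1 = n + 1
            · rw [if_pos hs]; simp only [hc, hs, if_true]; rfl
            · rw [if_neg hs, inv_one]; simp only [hc, hs, if_false]
          rw [← hce]; exact h
    have hS : wilsonAction ρ V ≤ (4 * t₂ + 2 * t₁ ^ 2) ^ 2 / 2 * Fintype.card (Plaquette 4 (n + 1)) :=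
      wilsonAction_le_of_toron ρ hU (fun μ => W (Lead μ)) ht₁ hlead hbox
    have hSU : wilsonAction ρ V = wilsonAction ρ U := by rw [hV, wilsonAction_gaugeTransform]
    show wilsonAction ρ U ≤ _
    rw [← hSU]; exact hS
  -- (4) assemble through the push-forward `map_combSection_pi_haar`
  have hmap := map_combSection_pi_haar (L := n + 1) (G := G)
  have hpre : PiM P ≤ (Measure.pi fun _ : Edge 4 (n + 1) => haarProbability G)
      {U : GaugeConfig 4 (n + 1) G | wilsonAction ρ U ≤ (4 * t₂ + 2 * t₁ ^ 2) ^ 2 / 2 * Fintype.card (Plaquette 4 (n + 1))} := by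
    rw [hPiM, ← hmap, Measure.map_apply measurable_combSection hPm]
    exact measure_mono hPsub
  rw [measureReal_def, measureReal_def, measureReal_def, ← ENNReal.toReal_pow, ← ENNReal.toReal_pow, ← ENNReal.toReal_mul]
  refine ENNReal.toReal_mono (measure_ne_top _ _) ?_
  rw [hcardp, hcardnp] at hPmass
  rw [← hPmass]
  exact hpre

end ToronBox

end Summit.QuantumFields.YangMills.Theorems.TwistExponentGap.ToronFloor

end
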